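import Summits.NavierStokesRegularity.NavierStokesRegularity.Theorems.FilamentSkeletonRssBoxSelectionRJ
import Summits.NavierStokesRegularity.NavierStokesRegularity.Theorems.FilamentSkeletonRssSkeletonJ1RSplit
import Summits.NavierStokesRegularity.NavierStokesRegularity.Theorems.FilamentSkeletonRssCoreGluingSplit
import Summits.NavierStokesRegularity.NavierStokesRegularity.Theorems.FilamentSkeletonRssCoreGluingProfileSuffices

/-!
# Route `FilamentSkeletonRss` · crux `SkeletonJ1R` (stmt-NavierStokesRegularity-23610) · crux idea `cofinal-selection` — FIRST LEMMA (sketch)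

The glue `Selection1AR` instantiates the ∀-side crux `TransverseReduction1AR` on ONE skeleton at `Γ = max Γ₁ Γ₂`; hence `closes` only ever
needs skeletons for a COFINAL set of circulations `Γ`.  `SkeletonJ1Rcof` = the crux with `∀ Γ ≥ Γ₂, ∃ skeleton` weakened to
`∀ Γ₁, ∃ Γ ≥ Γ₁, ∃ skeleton` (same matrix `J1RMatrix`, verbatim).  Two sorry-free facts: the crux implies it, and it feeds the selection glue
unchanged (`selection_cof : SkeletonJ1Rcof → TransverseReduction1AR → RssProfileExists`, port of `selection1AR_proof`).
MODEL rung, NEGATIVE side; nothing here bears on Navier–Stokes regularity. [folklore]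
-/

set_option linter.dupNamespace false

noncomputable section

namespace Summit.NavierStokesRegularity.NavierStokesRegularity.Cruxes.SkeletonJ1R.CofinalSelection

open Set Function Filter MeasureTheory Real
open Literature.Analysis.FluidPDE Literature.Analysis.FluidPDE.PineauVicol2026
open Summit.NavierStokesRegularity.NavierStokesRegularity.Theses.FilamentSkeletonRss
open Summit.NavierStokesRegularity.NavierStokesRegularity.Theorems (stub_rssProfileExists_of_profile splitGlue_rotGen_eq_cross_single_two)
open Summit.NavierStokesRegularity.NavierStokesRegularity.Theorems.FilamentSkeletonRssSkeletonJ1RSplit (J1RMatrix skeletonJ1R_iff_matrix)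
open scoped InnerProductSpace Laplacian ContDiff Topology BigOperators

/-- COFINAL form of the crux: skeleton constants as in `SkeletonJ1R`, but a skeleton is required only for a COFINAL set of circulations `Γ`
(`∀ Γ₁, ∃ Γ ≥ Γ₁, ∃ data, J1RMatrix …`) instead of for every `Γ ≥ Γ₂`. (route-posited candidate statement; not a Literature fact) -/
def SkeletonJ1Rcof : Prop :=
  ∃ (N : ℕ) (δ ρ K Λ a b cnd η Rw Rb cg θ₀ KA : ℝ), 0 < N ∧ 0 < δ ∧ 0 < ρ ∧ 0 ≤ a ∧ 0 < cnd ∧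
    0 < η ∧ 0 < Rw ∧ 0 < Rb ∧ 0 < cg ∧ 0 < θ₀ ∧ ∀ Γ₁ : ℝ, ∃ Γ : ℝ, Γ₁ ≤ Γ ∧
      ∃ (γ : Fin N → ℝ) (α : ℝ) (X : Fin N → ℝ → EuclideanSpace ℝ (Fin 3)) (w : Fin N → ℝ → ℝ) (c : Fin N → ℝ)
        (m n : Fin N → EuclideanSpace ℝ (Fin 3)) (Aa : Fin N → ℝ → ℝ), J1RMatrix N δ ρ K Λ a b cnd Rw Rb cg θ₀ KA Γ γ α X w c m n Aa

/-- The crux implies its cofinal form (take `Γ := max Γ₁ Γ₂`). [folklore] -/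
theorem skeletonJ1Rcof_of_skeletonJ1R (h : SkeletonJ1R) : SkeletonJ1Rcof := by
  obtain ⟨N, δ, ρ, K, Λ, a, b, cnd, η, Rw, Rb, cg, θ₀, KA, Γ₂, hN, hδ, hρ, ha, hcnd, hη, hRw, hRb, hcg, hθ₀, hbox⟩ :=
    skeletonJ1R_iff_matrix.mp h
  refine ⟨N, δ, ρ, K, Λ, a, b, cnd, η, Rw, Rb, cg, θ₀, KA, hN, hδ, hρ, ha, hcnd, hη, hRw, hRb, hcg, hθ₀, fun Γ₁ => ?_⟩
  exact ⟨max Γ₁ Γ₂, le_max_left _ _, hbox (max Γ₁ Γ₂) (le_max_right _ _)⟩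

/-- The selection glue runs UNCHANGED from the cofinal form (port of `selection1AR_proof`: get `Γ₁` from the ∀-crux, then a skeleton at some
`Γ ≥ Γ₁` from cofinality). [folklore] -/
theorem selection_cof (hbox : SkeletonJ1Rcof) (hred : TransverseReduction1AR) : RssProfileExists := by
  classical
  obtain ⟨N, δ, ρ, K, Λ, a, b, cnd, η, Rw, Rb, cg, θ₀, KA, hN, hδ, hρ, ha, _hcnd, hη, hRw, hRb, hcg, hθ₀, hbox⟩ := hbox
  obtain ⟨Γ₁, hred⟩ := hred N δ ρ K Λ a b cnd η Rw Rb cg θ₀ KA hN hδ hρ ha hη hRw hRb hcg hθ₀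
  obtain ⟨Γ, hΓ₁, γ, α, X, w, c, m, n, Aa, hfam⟩ := hbox Γ₁
  set u : (Fin N → ℝ → EuclideanSpace ℝ (Fin 3)) → EuclideanSpace ℝ (Fin 3) → EuclideanSpace ℝ (Fin 3) :=
    fun Z y => ∑ k : Fin N, (Γ * γ k / (4 * π)) • ∫ σ : ℝ,
        ((‖y - Z k σ‖ ^ 2 + Real.exp (-(1 + Real.eulerMascheroniConstant - Real.log 2)) * Aa k σ) ^ (3 / 2 : ℝ))⁻¹ •
          cross (deriv (Z k) σ) (y - Z k σ)
  set v : EuclideanSpace ℝ (Fin 3) → EuclideanSpace ℝ (Fin 3) :=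
    fun y => u X y + (1 / 2 : ℝ) • y - α • cross (EuclideanSpace.single (2 : Fin 3) (1 : ℝ)) y
  set A : Fin N → (EuclideanSpace ℝ (Fin 3) →L[ℝ] EuclideanSpace ℝ (Fin 3)) := fun j => fderiv ℝ v (X j (c j))
  set T : (Fin N → ℝ → EuclideanSpace ℝ (Fin 3)) → Fin N → ℝ → EuclideanSpace ℝ (Fin 3) :=
    fun Z j τ => (u Z (Z j τ) + (1 / 2 : ℝ) • Z j τ - α • cross (EuclideanSpace.single (2 : Fin 3) (1 : ℝ)) (Z j τ)) -
      (inner ℝ (u Z (Z j τ) + (1 / 2 : ℝ) • Z j τ - α • cross (EuclideanSpace.single (2 : Fin 3) (1 : ℝ)) (Z j τ)) (deriv (Z j) τ) /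
        ‖deriv (Z j) τ‖ ^ 2) • deriv (Z j) τ
  have hskel := hfam u v A T (fun _ _ => rfl) (fun _ => rfl) (fun _ => rfl) (fun _ _ _ => rfl)
  obtain ⟨α₁, C₀, M, U, P, hα₁, hU0, hUs, hPs, hdiv, heq, hdec, hPM, -⟩ := hred Γ hΓ₁ γ α X w c m n Aa u v A T
    (fun _ _ => rfl) (fun _ => rfl) (fun _ => rfl) (fun _ _ _ => rfl) hskel
  have heq0 : ∀ y : EuclideanSpace ℝ (Fin 3), α₁ • (rotGen (U y) - fderiv ℝ U y (rotGen y)) +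
      (1 / 2 : ℝ) • U y + (1 / 2 : ℝ) • fderiv ℝ U y y - (Δ U) y + fderiv ℝ U y (U y) + gradient P y = 0 := by
    intro y
    simp only [splitGlue_rotGen_eq_cross_single_two]
    exact heq y
  exact stub_rssProfileExists_of_profile ⟨α₁, C₀, M, U, P, hα₁, hU0, hUs, hPs, hdiv, heq0, hdec, hPM⟩

/-- Hence the route's deciding theorem re-threads from the cofinal form: same three other binders, same conclusion shape
(`RssProfileExists` is what `closes` extracts from `SkeletonJ1R ∧ TransverseReduction1AR` via `Selection1AR`). [folklore] -/
theorem rssProfileExists_of_cof (hbox : SkeletonJ1Rcof) (hred : TransverseReduction1AR) : RssProfileExists :=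
  selection_cof hbox hred

end Summit.NavierStokesRegularity.NavierStokesRegularity.Cruxes.SkeletonJ1R.CofinalSelection

end
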